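import Summits.BirchSwinnertonDyer.BirchSwinnertonDyer.Theorems.AdditiveBranchIMCMultLowerCycLineEndState
import Summits.BirchSwinnertonDyer.Rank1Residual.Additive.RankOneUpperHalfUnitRows
import Summits.BirchSwinnertonDyer.Rank1Residual.Additive.N10IsogenyTransport
import HarnessLib

/-!
# Route `AdditiveBranchIMC` (rung K1), crux `MultLower` (item 19359), cell (M), analytic rank ONE:
# the `#Ш_an`-UNIT WINDOW booking doors — `BSD(E,p)` on X4(M) ∩ surj and on X3♯(M) at EVERY odd `p`
# from PRINTED named facts + the Euler-system half + the per-pair bit `A′ ≠ 0` + the datum `ord_p #Ш(E)_an ≤ 0`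
# (cell `bsd-addord`, seat `bsd-addord-k1-c4` gen 6, D-0074 row B3; board B6 (M) r1)

HONEST FRAMING. THEOREMS ONLY: no definition, no named fact, no `sorry`, nothing booked; BSD is not proved
by any of this; crux `MultLower` (∀ `E/ℚ` of analytic rank `≤ 1`, ∀ odd additive potentially multiplicative
`p`: `ord_p #Ш(E)_an ≤ ord_p #Ш(E)`) stays OPEN at class level — exactly on its CONTENT window
`p ∣ #Ш(E)_an`, where the Λ-adic child `MultLambdaLower` (item 19590, NOT in print, gens 0–5 of this seat)
carries content (k1-c3's `multLower_of_window`, `Theorems/AdditiveBranchIMCLowerHalfWindow.lean`).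

THE OBSERVATION (k1-c3 gen 5 for the (G-ord) cell, file `…GordTwoRankOneShaAnUnit.lean`; here its (M) twin).
On a rank-one row carrying the per-pair DATUM "`#Ш(E)_an` is the rational `s`, `ord_p s ≤ 0`" the crux's
currency `Typed.MissingLowerBoundAt W p` holds with NO input (`N10.missingLowerBoundAt_of_padicValRat_le_zero`),
and `BSD(E,p)` = lower + upper needs only the UPPER half, which on cell (M) is a THEOREM of the tree modulo
print: n1011's `ClassX4M.missingUpperBoundAt_rankOne_of_katoHalf_of_branchPAdicGrossZagierMult` (Kato's
half-eigenspace divisibility under surj, `hK`) / `ClassX3M.missingUpperBoundAt_rankOne_of_wuthrichHalf_…`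
(Wuthrich Thm. 16, NO image hypothesis) at ONE (B)-height datum `Dh` with Delbourgo's leading-term clauses,
the Schneider rider and the typed (M) `p`-adic Gross–Zagier `BranchPAdicGrossZagierMultAt W p Dh`. Gen 4 of
this seat supplies that datum from PRINTED named facts
(`potMult_exists_leadingTermClauses_and_branchPAdicGrossZagierMultAt_of_cycLineFact`: Disegni's conjoined
fact (B) `hCyc` + Gross–Zagier I.(7.3) `h73` + Waldspurger `hWald` + modularity `hmodN hmod hmodD` + GZK +
Delbourgo 2002 (M) `hDelM`, regulator rigidity inside) and the rider from the typed identity + the per-pair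
bit `A′ ≠ 0` (`schneiderConjecture_of_branchPAdicGrossZagierMultAt_of_multCoeffOneNeZero`). Composing:

* §1 **X4(M) ∩ {`ρ̄_{E,p}` onto}, `r_an = 1`, EVERY odd `p` (`3` included, anomalous or not):** `BSD(E,p)` ⟸
  `hK` + cite-only `hCyc h73 hWald hmodN hDelM hmod hmodD hGZK` + the bit `A′ ≠ 0` + the datum (`ord_p s ≤ 0`,
  or the EXACT shape `padicValRat p q = 0` of the F3BW / D3X4R1 / T-BX4G-r1 desks) — NO Λ-adic input (19590),
  NO unit coefficient / first-unit-index / budget binder (compare gen 4's `…_of_firstUnitIndex_one/_of_budget`),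
  NO non-anomalous binder. ISOGENY-CLASS form by Cassels (`hCassels`, `N10.bsdp_of_isIsogenous_of_bsdp`).
* §2 **X3♯(M), `r_an = 1`, EVERY odd `p`:** the same with Wuthrich's half `hW16` in place of `hK` — NO image,
  tower, `hGVM`, `hAlg`, line-datum or Case-1 binder. On X3 keys the class may contain `p`-isogenous members
  with `p ∣ #Ш_an`: the class form closes them from ONE window member (§2, `…isogenous…`), and
  `N10.missingLowerBoundAt_of_isIsogenous_of_bsdp` returns the crux's currency at every member.
* §3 the crux's currency at EVERY member of a window key's isogeny class (both image families).

THE BIT `A′ ≠ 0` is displayed in gen 4's shape (the (M) twin of `BranchCoeffOneNeZeroAt`): for every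
MULTIPLICATIVE twist model `C • V^{(p*)} = W`, every newform `f` of `V`, `a_p = a_p(f) = ±1` and every period
ratio `ϖ` of the parity of `(p−1)/2`, `[T¹](ϖ · L^±_p(f, a_p, ω^{(p−1)/2}, T)) ≠ 0` — the ONE-TERM
Mazur–Tate–Teitelbaum branch at a multiplicative prime ("the twisted `p`-adic `L`-series of `V` has a zero of
order EXACTLY one on the `χ_{p*}`-branch"). It is a per-pair NUMERICAL certificate (two engines), not a
theorem; H3 of the cell applies verbatim. THE DATUM `#Ш(E)_an = s ∈ ℚ` in rank one is Gross–Zagier I.(7.3);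
its VALUE is table data (Cremona `allbsd` / LMFDB), an admitted per-pair currency (referee A R198.17 / R202.3,
T-BX3G-r1 R255, T-BX4G-r1 R379).

References: [Kato2004Asterisque] Thm. 17.4 (3); [Wuthrich2014] Thm. 16, Lemma 20; [Delbourgo2002] Thm. (A), (B);
[Disegni2017] Thm. A, B, Rem. 1.3.2; [GrossZagier1986] I.(7.3); [MazurTateTeitelbaum1986Invent] §I.10, §I.13–I.14;
[MilneADT2006] Thm. I.7.3; [Miller2011LMS] §1, Def. 1.1; cell TARGET.md §2 (content window); HOME/k1-c3/x4r1-g6/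
(the (G-ord) booking of record this file mirrors).
-/

set_option autoImplicit false
set_option linter.dupNamespace false

noncomputable section

open scoped Classical MatrixGroups ModularForm NumberField

namespace Summit.BirchSwinnertonDyer.BirchSwinnertonDyer.Theorems.AdditiveBranchIMCMultLower

open CongruenceSubgroup WeierstrassCurve NumberField Literature.NumberTheory.EllipticCurves
  Literature.NumberTheory.EllipticCurves.ModularForms Literature.NumberTheory.EllipticCurves.Rank1Residual
  Literature.NumberTheory.EllipticCurves.Rank1Residual.Typed
  Literature.NumberTheory.EllipticCurves.Delbourgo2002
  Literature.NumberTheory.EllipticCurves.Disegni2017 Literature.NumberTheory.QuadraticFields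
  Literature.NumberTheory.GaloisRepresentations
  Summit.BirchSwinnertonDyer.Rank1Residual.Additive
  Summit.BirchSwinnertonDyer.Rank1Residual.AdditivePotMult
  Summit.BirchSwinnertonDyer.BirchSwinnertonDyer.Theses.AdditiveBranchIMC

variable {W : WeierstrassCurve ℚ} [W.IsElliptic] [W.IsGloballyMinimal] {p : ℕ} [hp : Fact p.Prime]

/-! ### §1 X4(M) ∩ surj, analytic rank one, every odd `p`: `BSD(E,p)` on the `#Ш_an`-unit window -/

/-- **X4(M) ∩ {`ρ̄_{E,p}` onto}, `r_an(E) = 1`, ANY odd `p` (`3` included, anomalous or not): `BSD(E,p)` from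
Kato's half-eigenspace reading `hK`, the cite-only facts `hCyc h73 hWald hmodN hDelM hmod hmodD hGZK`, the
per-pair bit `A′ ≠ 0` on the multiplicative `χ_{p*}`-branch (`hne`, gen 4's shape) and the datum
`#Ш(E)_an = s`, `ord_p s ≤ 0`.** Lower half: the window (input-free). Upper half: n1011's
`ClassX4M.missingUpperBoundAt_rankOne_of_katoHalf_of_branchPAdicGrossZagierMult` at the (B)-datum supplied from
print by gen 4 (`potMult_exists_leadingTermClauses_and_branchPAdicGrossZagierMultAt_of_cycLineFact`), Schneider
rider from the typed identity + the bit. NO Λ-adic, unit-coefficient, budget or non-anomalous binder. Per pair;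
nothing booked. [cite: Kato2004Asterisque, Thm. 17.4 (3) (p. 273)] [cite: Wuthrich2014, Lemma 20 (p. 399)]
[cite: Delbourgo2002, Theorem (A), (B) (p. 40)] [cite: Disegni2017, Theorem A/B (arXiv v3 PDF 7–9), Rem. 1.3.2]
[cite: GrossZagier1986, Thm. I.(7.3)] [cite: MazurTateTeitelbaum1986Invent, §I.10, §I.13–I.14]
[cite: Miller2011LMS, §1 and Def. 1.1] -/
theorem classX4M_bsdp_rankOne_of_cycLineFact_of_katoHalf_of_multCoeffOneNeZero_of_shaAnWindow
    (hCyc : delbourgoDatum_cycLineGrossZagier) (h73 : GrossZagier1986_thm_I_7_3)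
    (hWald : waldspurger_exists_heegnerField_twist_ne_zero) (hmodN : exists_isNewformOf)
    (hDelM : Delbourgo2002.mainTheorem_potMult)
    (hK : Wuthrich2014.kato_halfEigenCharIdeal_dvd_cyclotomicPrime_of_surjective)
    (hmod : hasEntireLFunction_rat) (hmodD : nonempty_modularParametrizationData)
    (hGZK : rank_eq_analyticRank_of_analyticRank_le_one)
    (hX : ClassX4M W p) (hsurj : Surj W p) (hr : W.analyticRank = 1)
    (hne : ∀ (V : WeierstrassCurve ℚ) [V.IsElliptic] [V.IsGloballyMinimal] (C : VariableChange ℚ),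
      Mult V p → C • V.quadraticTwist ((-1 : ℚ) ^ (p / 2) * p) = W →
      ∀ {N : ℕ} [NeZero N] (f : CuspForm (Gamma0 N) 2), IsNewformOf V f → ∀ (ap : ℤ), cuspCoeff f p = ap →
      ∀ ϖ : ℚ, (if Even (p / 2) then (ϖ : ℝ) * V.realPeriodRat = plusPeriod f
          else (ϖ : ℝ) * V.imaginaryPeriodRat = minusPeriod f) →
        PowerSeries.coeff 1 (PowerSeries.C (ϖ : ℚ_[p]) *
            (if Even (p / 2) then padicLFunctionPlusBranchMult f (ap : ℚ_[p]) (p / 2)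
              else padicLFunctionMinusBranchMult f (ap : ℚ_[p]) (p / 2))) ≠ 0)
    {s : ℚ} (hs : shaAn W = (s : ℂ)) (hsv : padicValRat p s ≤ 0) : BSDp W p := by
  have hp2 : p ≠ 2 := hX.p_ne_two
  obtain ⟨Dh, hB, hGZ⟩ :=
    potMult_exists_leadingTermClauses_and_branchPAdicGrossZagierMultAt_of_cycLineFact hCyc h73 hWald hmodN
      hmod hmodD hGZK hDelM hX.potMult hp2 hr
  obtain ⟨V, iV, iVm, C, hV, hC⟩ := hX.potMult.exists_mult_pStar_twist_model hp2
  have hS : SchneiderConjecture Dh :=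
    schneiderConjecture_of_branchPAdicGrossZagierMultAt_of_multCoeffOneNeZero hp2 hmodD hGZK hr hGZ hne V C
      hV hC
  have hu : MissingUpperBoundAt W p :=
    ClassX4M.missingUpperBoundAt_rankOne_of_katoHalf_of_branchPAdicGrossZagierMult hK hGZK hmod hmodD hX
      hsurj hr hB hS hGZ
  exact bsdp_of_missingPPartAt W p hGZK (by rw [hr])
    (missingPPartAt_of_lower_of_upper W p (N10.missingLowerBoundAt_of_padicValRat_le_zero W p hs hsv) hu)

/-- **The same door in the EXACT-`#Ш_an` currency** of the F3BW / D3X4R1 / T-BX4G-r1 booking desks: datum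
`#Ш(E)_an = q ∈ ℚ` with `padicValRat p q = 0` (Cremona / LMFDB value, `p ∤ #Ш_an`). Per pair; nothing booked.
[cite: Kato2004Asterisque, Thm. 17.4 (3) (p. 273)] [cite: Delbourgo2002, Theorem (A), (B) (p. 40)]
[cite: Disegni2017, Theorem A/B] [cite: Miller2011LMS, §1 and Def. 1.1] -/
theorem classX4M_bsdp_rankOne_of_cycLineFact_of_katoHalf_of_multCoeffOneNeZero_of_shaAnExact
    (hCyc : delbourgoDatum_cycLineGrossZagier) (h73 : GrossZagier1986_thm_I_7_3)
    (hWald : waldspurger_exists_heegnerField_twist_ne_zero) (hmodN : exists_isNewformOf)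
    (hDelM : Delbourgo2002.mainTheorem_potMult)
    (hK : Wuthrich2014.kato_halfEigenCharIdeal_dvd_cyclotomicPrime_of_surjective)
    (hmod : hasEntireLFunction_rat) (hmodD : nonempty_modularParametrizationData)
    (hGZK : rank_eq_analyticRank_of_analyticRank_le_one)
    (hX : ClassX4M W p) (hsurj : Surj W p) (hr : W.analyticRank = 1)
    (hne : ∀ (V : WeierstrassCurve ℚ) [V.IsElliptic] [V.IsGloballyMinimal] (C : VariableChange ℚ),
      Mult V p → C • V.quadraticTwist ((-1 : ℚ) ^ (p / 2) * p) = W →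
      ∀ {N : ℕ} [NeZero N] (f : CuspForm (Gamma0 N) 2), IsNewformOf V f → ∀ (ap : ℤ), cuspCoeff f p = ap →
      ∀ ϖ : ℚ, (if Even (p / 2) then (ϖ : ℝ) * V.realPeriodRat = plusPeriod f
          else (ϖ : ℝ) * V.imaginaryPeriodRat = minusPeriod f) →
        PowerSeries.coeff 1 (PowerSeries.C (ϖ : ℚ_[p]) *
            (if Even (p / 2) then padicLFunctionPlusBranchMult f (ap : ℚ_[p]) (p / 2)
              else padicLFunctionMinusBranchMult f (ap : ℚ_[p]) (p / 2))) ≠ 0)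
    {q : ℚ} (hq : shaAn W = (q : ℂ)) (hv : padicValRat p q = 0) : BSDp W p :=
  classX4M_bsdp_rankOne_of_cycLineFact_of_katoHalf_of_multCoeffOneNeZero_of_shaAnWindow hCyc h73 hWald hmodN
    hDelM hK hmod hmodD hGZK hX hsurj hr hne hq hv.le

/-- **ISOGENY-CLASS FORM (the booking unit is the class), X4(M) ∩ surj, `r_an = 1`, every odd `p`.** For every
globally minimal `E'` `ℚ`-isogenous to the member `E` carrying the door's inputs (X4(M) ∩ surj at `p`,
`r_an = 1`, the bit `A′ ≠ 0`, `#Ш(E)_an = s` with `ord_p s ≤ 0`), `BSD(E',p)` — Cassels' isogeny invariance of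
the BSD quotient (`hCassels`, through the cell's `N10.bsdp_of_isIsogenous_of_bsdp`; the analytic rank is an
isogeny invariant unconditionally). [cite: MilneADT2006, Thm. I.7.3 and Remark I.7.4]
[cite: Kato2004Asterisque, Thm. 17.4 (3) (p. 273)] [cite: Delbourgo2002, Theorem (A), (B) (p. 40)]
[cite: Disegni2017, Theorem A/B] [cite: Miller2011LMS, §1 and Def. 1.1] -/
theorem isogenous_bsdp_rankOne_of_classX4M_of_cycLineFact_of_katoHalf_of_multCoeffOneNeZero_of_shaAnWindow
    (hCassels : bsdRHS_eq_of_isIsogenous)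
    (hCyc : delbourgoDatum_cycLineGrossZagier) (h73 : GrossZagier1986_thm_I_7_3)
    (hWald : waldspurger_exists_heegnerField_twist_ne_zero) (hmodN : exists_isNewformOf)
    (hDelM : Delbourgo2002.mainTheorem_potMult)
    (hK : Wuthrich2014.kato_halfEigenCharIdeal_dvd_cyclotomicPrime_of_surjective)
    (hmod : hasEntireLFunction_rat) (hmodD : nonempty_modularParametrizationData)
    (hGZK : rank_eq_analyticRank_of_analyticRank_le_one)
    {W' : WeierstrassCurve ℚ} [W'.IsElliptic] [W'.IsGloballyMinimal] (hiso : IsIsogenous W' W)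
    (hX : ClassX4M W p) (hsurj : Surj W p) (hr : W.analyticRank = 1)
    (hne : ∀ (V : WeierstrassCurve ℚ) [V.IsElliptic] [V.IsGloballyMinimal] (C : VariableChange ℚ),
      Mult V p → C • V.quadraticTwist ((-1 : ℚ) ^ (p / 2) * p) = W →
      ∀ {N : ℕ} [NeZero N] (f : CuspForm (Gamma0 N) 2), IsNewformOf V f → ∀ (ap : ℤ), cuspCoeff f p = ap →
      ∀ ϖ : ℚ, (if Even (p / 2) then (ϖ : ℝ) * V.realPeriodRat = plusPeriod f
          else (ϖ : ℝ) * V.imaginaryPeriodRat = minusPeriod f) →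
        PowerSeries.coeff 1 (PowerSeries.C (ϖ : ℚ_[p]) *
            (if Even (p / 2) then padicLFunctionPlusBranchMult f (ap : ℚ_[p]) (p / 2)
              else padicLFunctionMinusBranchMult f (ap : ℚ_[p]) (p / 2))) ≠ 0)
    {s : ℚ} (hs : shaAn W = (s : ℂ)) (hsv : padicValRat p s ≤ 0) : BSDp W' p := by
  have hr' : W'.analyticRank ≤ 1 := by rw [analyticRank_eq_of_isIsogenous' hiso, hr]
  exact N10.bsdp_of_isIsogenous_of_bsdp p hCassels hGZK hmod hiso hr'
    (classX4M_bsdp_rankOne_of_cycLineFact_of_katoHalf_of_multCoeffOneNeZero_of_shaAnWindow hCyc h73 hWald hmodN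
      hDelM hK hmod hmodD hGZK hX hsurj hr hne hs hsv)

/-! ### §2 X3♯(M), analytic rank one, every odd `p`: `BSD(E,p)` on the `#Ш_an`-unit window (NO image hypothesis) -/

/-- **X3♯(M) (`E[p]` reducible), `r_an(E) = 1`, ANY odd `p`: `BSD(E,p)` from Wuthrich's Thm. 16 half `hW16`,
the cite-only facts `hCyc h73 hWald hmodN hDelM hmod hmodD hGZK`, the per-pair bit `A′ ≠ 0` (`hne`) and the
datum `#Ш(E)_an = s`, `ord_p s ≤ 0`.** Upper half: n1011's
`ClassX3M.missingUpperBoundAt_rankOne_of_wuthrichHalf_of_branchPAdicGrossZagierMult` at gen 4's printed datum;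
rider from the identity + the bit. NO image / tower / `hGVM` / `hAlg` / line-datum / Case-1 / non-anomalous
binder. Per pair; nothing booked. [cite: Wuthrich2014, Thm. 16 (p. 397)]
[cite: Delbourgo2002, Theorem (A), (B) (p. 40)] [cite: Disegni2017, Theorem A/B (arXiv v3 PDF 7–9), Rem. 1.3.2]
[cite: GrossZagier1986, Thm. I.(7.3)] [cite: MazurTateTeitelbaum1986Invent, §I.10, §I.13–I.14]
[cite: Miller2011LMS, §1 and Def. 1.1] -/
theorem classX3M_bsdp_rankOne_of_cycLineFact_of_wuthrichHalf_of_multCoeffOneNeZero_of_shaAnWindow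
    (hCyc : delbourgoDatum_cycLineGrossZagier) (h73 : GrossZagier1986_thm_I_7_3)
    (hWald : waldspurger_exists_heegnerField_twist_ne_zero) (hmodN : exists_isNewformOf)
    (hDelM : Delbourgo2002.mainTheorem_potMult)
    (hW16 : Wuthrich2014.thm16_halfEigenCharIdeal_dvd_cyclotomicPrime)
    (hmod : hasEntireLFunction_rat) (hmodD : nonempty_modularParametrizationData)
    (hGZK : rank_eq_analyticRank_of_analyticRank_le_one)
    (hX : ClassX3M W p) (hr : W.analyticRank = 1)
    (hne : ∀ (V : WeierstrassCurve ℚ) [V.IsElliptic] [V.IsGloballyMinimal] (C : VariableChange ℚ),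
      Mult V p → C • V.quadraticTwist ((-1 : ℚ) ^ (p / 2) * p) = W →
      ∀ {N : ℕ} [NeZero N] (f : CuspForm (Gamma0 N) 2), IsNewformOf V f → ∀ (ap : ℤ), cuspCoeff f p = ap →
      ∀ ϖ : ℚ, (if Even (p / 2) then (ϖ : ℝ) * V.realPeriodRat = plusPeriod f
          else (ϖ : ℝ) * V.imaginaryPeriodRat = minusPeriod f) →
        PowerSeries.coeff 1 (PowerSeries.C (ϖ : ℚ_[p]) *
            (if Even (p / 2) then padicLFunctionPlusBranchMult f (ap : ℚ_[p]) (p / 2)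
              else padicLFunctionMinusBranchMult f (ap : ℚ_[p]) (p / 2))) ≠ 0)
    {s : ℚ} (hs : shaAn W = (s : ℂ)) (hsv : padicValRat p s ≤ 0) : BSDp W p := by
  have hp2 : p ≠ 2 := hX.p_ne_two
  obtain ⟨Dh, hB, hGZ⟩ :=
    potMult_exists_leadingTermClauses_and_branchPAdicGrossZagierMultAt_of_cycLineFact hCyc h73 hWald hmodN
      hmod hmodD hGZK hDelM hX.potMult hp2 hr
  obtain ⟨V, iV, iVm, C, hV, hC⟩ := hX.potMult.exists_mult_pStar_twist_model hp2
  have hS : SchneiderConjecture Dh :=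
    schneiderConjecture_of_branchPAdicGrossZagierMultAt_of_multCoeffOneNeZero hp2 hmodD hGZK hr hGZ hne V C
      hV hC
  have hu : MissingUpperBoundAt W p :=
    ClassX3M.missingUpperBoundAt_rankOne_of_wuthrichHalf_of_branchPAdicGrossZagierMult hW16 hGZK hmod hmodD hX
      hr hB hS hGZ
  exact bsdp_of_missingPPartAt W p hGZK (by rw [hr])
    (missingPPartAt_of_lower_of_upper W p (N10.missingLowerBoundAt_of_padicValRat_le_zero W p hs hsv) hu)

/-- **X3♯(M), EXACT-`#Ш_an` currency**: datum `#Ш(E)_an = q ∈ ℚ` with `padicValRat p q = 0`. Per pair; nothing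
booked. [cite: Wuthrich2014, Thm. 16 (p. 397)] [cite: Delbourgo2002, Theorem (A), (B) (p. 40)]
[cite: Disegni2017, Theorem A/B] [cite: Miller2011LMS, §1 and Def. 1.1] -/
theorem classX3M_bsdp_rankOne_of_cycLineFact_of_wuthrichHalf_of_multCoeffOneNeZero_of_shaAnExact
    (hCyc : delbourgoDatum_cycLineGrossZagier) (h73 : GrossZagier1986_thm_I_7_3)
    (hWald : waldspurger_exists_heegnerField_twist_ne_zero) (hmodN : exists_isNewformOf)
    (hDelM : Delbourgo2002.mainTheorem_potMult)
    (hW16 : Wuthrich2014.thm16_halfEigenCharIdeal_dvd_cyclotomicPrime)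
    (hmod : hasEntireLFunction_rat) (hmodD : nonempty_modularParametrizationData)
    (hGZK : rank_eq_analyticRank_of_analyticRank_le_one)
    (hX : ClassX3M W p) (hr : W.analyticRank = 1)
    (hne : ∀ (V : WeierstrassCurve ℚ) [V.IsElliptic] [V.IsGloballyMinimal] (C : VariableChange ℚ),
      Mult V p → C • V.quadraticTwist ((-1 : ℚ) ^ (p / 2) * p) = W →
      ∀ {N : ℕ} [NeZero N] (f : CuspForm (Gamma0 N) 2), IsNewformOf V f → ∀ (ap : ℤ), cuspCoeff f p = ap →
      ∀ ϖ : ℚ, (if Even (p / 2) then (ϖ : ℝ) * V.realPeriodRat = plusPeriod f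
          else (ϖ : ℝ) * V.imaginaryPeriodRat = minusPeriod f) →
        PowerSeries.coeff 1 (PowerSeries.C (ϖ : ℚ_[p]) *
            (if Even (p / 2) then padicLFunctionPlusBranchMult f (ap : ℚ_[p]) (p / 2)
              else padicLFunctionMinusBranchMult f (ap : ℚ_[p]) (p / 2))) ≠ 0)
    {q : ℚ} (hq : shaAn W = (q : ℂ)) (hv : padicValRat p q = 0) : BSDp W p :=
  classX3M_bsdp_rankOne_of_cycLineFact_of_wuthrichHalf_of_multCoeffOneNeZero_of_shaAnWindow hCyc h73 hWald
    hmodN hDelM hW16 hmod hmodD hGZK hX hr hne hq hv.le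

/-- **ISOGENY-CLASS FORM, X3♯(M), `r_an = 1`, every odd `p`.** For every globally minimal `E'` `ℚ`-isogenous
to the member `E` carrying the door's inputs, `BSD(E',p)` (Cassels, `hCassels`). On X3 keys the class may
contain `p`-isogenous members `E'` with `p ∣ #Ш(E')_an` (outside the window): they are closed from ONE window
member. [cite: MilneADT2006, Thm. I.7.3 and Remark I.7.4] [cite: Wuthrich2014, Thm. 16 (p. 397)]
[cite: Delbourgo2002, Theorem (A), (B) (p. 40)] [cite: Disegni2017, Theorem A/B] [cite: Miller2011LMS, §1 and Def. 1.1] -/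
theorem isogenous_bsdp_rankOne_of_classX3M_of_cycLineFact_of_wuthrichHalf_of_multCoeffOneNeZero_of_shaAnWindow
    (hCassels : bsdRHS_eq_of_isIsogenous)
    (hCyc : delbourgoDatum_cycLineGrossZagier) (h73 : GrossZagier1986_thm_I_7_3)
    (hWald : waldspurger_exists_heegnerField_twist_ne_zero) (hmodN : exists_isNewformOf)
    (hDelM : Delbourgo2002.mainTheorem_potMult)
    (hW16 : Wuthrich2014.thm16_halfEigenCharIdeal_dvd_cyclotomicPrime)
    (hmod : hasEntireLFunction_rat) (hmodD : nonempty_modularParametrizationData)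
    (hGZK : rank_eq_analyticRank_of_analyticRank_le_one)
    {W' : WeierstrassCurve ℚ} [W'.IsElliptic] [W'.IsGloballyMinimal] (hiso : IsIsogenous W' W)
    (hX : ClassX3M W p) (hr : W.analyticRank = 1)
    (hne : ∀ (V : WeierstrassCurve ℚ) [V.IsElliptic] [V.IsGloballyMinimal] (C : VariableChange ℚ),
      Mult V p → C • V.quadraticTwist ((-1 : ℚ) ^ (p / 2) * p) = W →
      ∀ {N : ℕ} [NeZero N] (f : CuspForm (Gamma0 N) 2), IsNewformOf V f → ∀ (ap : ℤ), cuspCoeff f p = ap →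
      ∀ ϖ : ℚ, (if Even (p / 2) then (ϖ : ℝ) * V.realPeriodRat = plusPeriod f
          else (ϖ : ℝ) * V.imaginaryPeriodRat = minusPeriod f) →
        PowerSeries.coeff 1 (PowerSeries.C (ϖ : ℚ_[p]) *
            (if Even (p / 2) then padicLFunctionPlusBranchMult f (ap : ℚ_[p]) (p / 2)
              else padicLFunctionMinusBranchMult f (ap : ℚ_[p]) (p / 2))) ≠ 0)
    {s : ℚ} (hs : shaAn W = (s : ℂ)) (hsv : padicValRat p s ≤ 0) : BSDp W' p := by
  have hr' : W'.analyticRank ≤ 1 := by rw [analyticRank_eq_of_isIsogenous' hiso, hr]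
  exact N10.bsdp_of_isIsogenous_of_bsdp p hCassels hGZK hmod hiso hr'
    (classX3M_bsdp_rankOne_of_cycLineFact_of_wuthrichHalf_of_multCoeffOneNeZero_of_shaAnWindow hCyc h73 hWald
      hmodN hDelM hW16 hmod hmodD hGZK hX hr hne hs hsv)

/-! ### §3 The crux's own currency at EVERY member of a window key's class -/

/-- **Crux currency by transport, X4(M) ∩ surj key.** On a window key (member `E` with the §1 inputs), the crux's
conclusion `ord_p #Ш(E')_an ≤ ord_p #Ш(E')` holds at EVERY globally minimal `E'` `ℚ`-isogenous to `E` —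
whatever `ord_p #Ш(E')_an` is (`BSD(E',p)` by §1's class form, then `N10.missingLowerBoundAt_of_isIsogenous_of_bsdp`'s
reading). Per key; nothing booked. [cite: MilneADT2006, Thm. I.7.3] [cite: Kato2004Asterisque, Thm. 17.4 (3) (p. 273)]
[cite: Disegni2017, Theorem A/B] [cite: Miller2011LMS, Def. 1.1] -/
theorem isogenous_missingLowerBoundAt_rankOne_of_classX4M_of_cycLineFact_of_katoHalf_of_multCoeffOneNeZero_of_shaAnWindow
    (hCassels : bsdRHS_eq_of_isIsogenous)
    (hCyc : delbourgoDatum_cycLineGrossZagier) (h73 : GrossZagier1986_thm_I_7_3)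
    (hWald : waldspurger_exists_heegnerField_twist_ne_zero) (hmodN : exists_isNewformOf)
    (hDelM : Delbourgo2002.mainTheorem_potMult)
    (hK : Wuthrich2014.kato_halfEigenCharIdeal_dvd_cyclotomicPrime_of_surjective)
    (hmod : hasEntireLFunction_rat) (hmodD : nonempty_modularParametrizationData)
    (hGZK : rank_eq_analyticRank_of_analyticRank_le_one)
    {W' : WeierstrassCurve ℚ} [W'.IsElliptic] [W'.IsGloballyMinimal] (hiso : IsIsogenous W' W)
    (hX : ClassX4M W p) (hsurj : Surj W p) (hr : W.analyticRank = 1)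
    (hne : ∀ (V : WeierstrassCurve ℚ) [V.IsElliptic] [V.IsGloballyMinimal] (C : VariableChange ℚ),
      Mult V p → C • V.quadraticTwist ((-1 : ℚ) ^ (p / 2) * p) = W →
      ∀ {N : ℕ} [NeZero N] (f : CuspForm (Gamma0 N) 2), IsNewformOf V f → ∀ (ap : ℤ), cuspCoeff f p = ap →
      ∀ ϖ : ℚ, (if Even (p / 2) then (ϖ : ℝ) * V.realPeriodRat = plusPeriod f
          else (ϖ : ℝ) * V.imaginaryPeriodRat = minusPeriod f) →
        PowerSeries.coeff 1 (PowerSeries.C (ϖ : ℚ_[p]) *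
            (if Even (p / 2) then padicLFunctionPlusBranchMult f (ap : ℚ_[p]) (p / 2)
              else padicLFunctionMinusBranchMult f (ap : ℚ_[p]) (p / 2))) ≠ 0)
    {s : ℚ} (hs : shaAn W = (s : ℂ)) (hsv : padicValRat p s ≤ 0) : MissingLowerBoundAt W' p := by
  have hpp : BSDp W' p :=
    isogenous_bsdp_rankOne_of_classX4M_of_cycLineFact_of_katoHalf_of_multCoeffOneNeZero_of_shaAnWindow hCassels
      hCyc h73 hWald hmodN hDelM hK hmod hmodD hGZK hiso hX hsurj hr hne hs hsv
  have hr' : W'.analyticRank ≤ 1 := by rw [analyticRank_eq_of_isIsogenous' hiso, hr]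
  haveI : Finite W'.sha := (hGZK W' hr').2
  exact (lower_and_upper_of_missingPPartAt W' p (missingPPartAt_of_bsdp W' p hpp)).1

/-- **Crux currency by transport, X3♯(M) key** (classes with `p`-isogenies: members outside the window are
reached from ONE window member). Per key; nothing booked. [cite: MilneADT2006, Thm. I.7.3]
[cite: Wuthrich2014, Thm. 16 (p. 397)] [cite: Disegni2017, Theorem A/B] [cite: Miller2011LMS, Def. 1.1] -/
theorem isogenous_missingLowerBoundAt_rankOne_of_classX3M_of_cycLineFact_of_wuthrichHalf_of_multCoeffOneNeZero_of_shaAnWindow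
    (hCassels : bsdRHS_eq_of_isIsogenous)
    (hCyc : delbourgoDatum_cycLineGrossZagier) (h73 : GrossZagier1986_thm_I_7_3)
    (hWald : waldspurger_exists_heegnerField_twist_ne_zero) (hmodN : exists_isNewformOf)
    (hDelM : Delbourgo2002.mainTheorem_potMult)
    (hW16 : Wuthrich2014.thm16_halfEigenCharIdeal_dvd_cyclotomicPrime)
    (hmod : hasEntireLFunction_rat) (hmodD : nonempty_modularParametrizationData)
    (hGZK : rank_eq_analyticRank_of_analyticRank_le_one)
    {W' : WeierstrassCurve ℚ} [W'.IsElliptic] [W'.IsGloballyMinimal] (hiso : IsIsogenous W' W)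
    (hX : ClassX3M W p) (hr : W.analyticRank = 1)
    (hne : ∀ (V : WeierstrassCurve ℚ) [V.IsElliptic] [V.IsGloballyMinimal] (C : VariableChange ℚ),
      Mult V p → C • V.quadraticTwist ((-1 : ℚ) ^ (p / 2) * p) = W →
      ∀ {N : ℕ} [NeZero N] (f : CuspForm (Gamma0 N) 2), IsNewformOf V f → ∀ (ap : ℤ), cuspCoeff f p = ap →
      ∀ ϖ : ℚ, (if Even (p / 2) then (ϖ : ℝ) * V.realPeriodRat = plusPeriod f
          else (ϖ : ℝ) * V.imaginaryPeriodRat = minusPeriod f) →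
        PowerSeries.coeff 1 (PowerSeries.C (ϖ : ℚ_[p]) *
            (if Even (p / 2) then padicLFunctionPlusBranchMult f (ap : ℚ_[p]) (p / 2)
              else padicLFunctionMinusBranchMult f (ap : ℚ_[p]) (p / 2))) ≠ 0)
    {s : ℚ} (hs : shaAn W = (s : ℂ)) (hsv : padicValRat p s ≤ 0) : MissingLowerBoundAt W' p := by
  have hpp : BSDp W' p :=
    isogenous_bsdp_rankOne_of_classX3M_of_cycLineFact_of_wuthrichHalf_of_multCoeffOneNeZero_of_shaAnWindow
      hCassels hCyc h73 hWald hmodN hDelM hW16 hmod hmodD hGZK hiso hX hr hne hs hsv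
  have hr' : W'.analyticRank ≤ 1 := by rw [analyticRank_eq_of_isIsogenous' hiso, hr]
  haveI : Finite W'.sha := (hGZK W' hr').2
  exact (lower_and_upper_of_missingPPartAt W' p (missingPPartAt_of_bsdp W' p hpp)).1

end Summit.BirchSwinnertonDyer.BirchSwinnertonDyer.Theorems.AdditiveBranchIMCMultLower

end
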